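import Summits.BirchSwinnertonDyer.BirchSwinnertonDyer.Theorems.PrintCf2SplitBadTwoQuadraticPartAvatar
import Summits.BirchSwinnertonDyer.BirchSwinnertonDyer.Theorems.PrintCf2SplitBadTwoAvatarRigidity
import Literature.NumberTheory.GaloisRepresentations.WeakAbelianDirectSummandTwistProofs
import HarnessLib

/-!
# The v10 triple `(θK, ρ, r)` from a `ℤ₂ˣ`-valued avatar: `θK` quadratic, `ρ := θK·λ`,
# `r := (avatar of λ) ⊗ (sign)` IS an avatar of `ρ` and factors through EVERY generator pair of the
# `ℤ₂²`-tower (width brick B11d-ii, road α — everything but O2′)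

Cell `bsd-print-cf2`, seat `bsd-line-cf2-p1-w4` g7, crux `stmt-BirchSwinnertonDyer-20368`
`PrintCf2.SplitBadTwoRankOneOfFacts`.  Theses-free; `--supports` the crux.  The v10 frame of S2′/S3b′
(planner g16 sketch; the same data instantiates S3a in v9.1) binds
`∀ (θK ρ : HeckeCharacter K) (r : FramedGaloisRep K ℚ̄₂ 1), θK * θK = 1 → IsPAdicAvatarOf ι ρ r →
FactorsThroughPair κ₁ κ₂ r → θK⁻¹ * ρ = (ψ∘c)⁻¹ → …`.  THIS FILE produces such a triple from the single
remaining input O2′ — a `ℤ₂ˣ`-VALUED avatar of `λ := (ψ∘c)⁻¹`, i.e. a continuous `χ : Γ_K →ₜ* ℤ₂ˣ` and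
a framed `r₀ : Γ_K →ₜ* GL₁(ℚ̄₂)` with entries `χ(σ)` and `IsPAdicAvatarOf ι λ r₀` — for ANY algebraic
Hecke character `λ` of an imaginary quadratic `K` and EVERY generator pair:

* **`exists_v10_triple`**: `∃ θK ρ r` (and the sign `θ̂`, S3a's framed `θ` with `θ² = 1`,
  `KellerYin2024.IsHeckeCharOf ι θ θK`, exact ramification) with `θK * θK = 1`, `ρ = θK * λ`,
  `θK⁻¹ * ρ = λ`, `IsPAdicAvatarOf ι ρ r`, entries `r(σ)₀₀ = χ(σ)·θ̂(σ)`, and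
  `FactorsThroughPair κ₁ κ₂ r` for EVERY generator pair `(κ₁, κ₂; γ₁, γ₂)` of the `ℤ₂²`-tower.
  Ingredients: the sign package `QuadraticPart.exists_sign_heckeChar_avatar` (B11–B11c), the avatar
  product `AvatarRigidity.isPAdicAvatarOf_mul_twist` (B11d-i; NO ramification hypothesis — `θK` and `λ`
  are both ramified above `7d`), `HeckeCharacter.IsFiniteOrder.isAlgebraic`, `IsAlgebraic.mul`, and
  B11's `factorsThroughPair_of_sign_twist` (`χ·θ̂` dies on `pairKer`).

HONEST FRAMING: assembly of earlier bricks; closes nothing; O2′ (that the avatar of `(ψ∘c)⁻¹` for the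
class is `ℤ₂ˣ`-valued: `ψ` takes values in `K = ℚ(√−7)` and `K_v = ℚ₂`) is NOT here.  beyond-print
theorem: no.  BSD is not proved by any of this.

References: [deShalit1987] II.4.17 (54); [SerreAbelianLadic1968] Ch. II §2.7; [CastellaHsieh2018] §3.3.
-/

-- the summit namespace `Summit.BirchSwinnertonDyer.BirchSwinnertonDyer` repeats the problem name by design (D-0017)
set_option linter.dupNamespace false
set_option autoImplicit false

noncomputable section

open scoped Classical

open Polynomial NumberField IsDedekindDomain Field
  Literature.NumberTheory.EllipticCurves Literature.NumberTheory.GaloisRepresentations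
  Literature.NumberTheory.EllipticCurves.KellerYin2024

namespace Summit.BirchSwinnertonDyer.BirchSwinnertonDyer.Theorems.PrintCf2.QuadraticPart

variable {K : Type} [Field K] [NumberField K] (S : Set (PadicAlgCl 2)) (ι : PadicAlgCl 2 ≃+* ℂ)

/-- **The v10 triple from a `ℤ₂ˣ`-valued avatar.**  `K` imaginary quadratic, `λ` an ALGEBRAIC Hecke
character of `K` with a `ℤ₂ˣ`-valued `2`-adic avatar: a continuous `χ : Γ_K →ₜ* ℤ₂ˣ` and a framed
`r₀ : Γ_K →ₜ* GL₁(ℚ̄₂)` with entries `r₀(σ)₀₀ = χ(σ)` and `IsPAdicAvatarOf ι λ r₀`.  Then there are the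
sign `θ̂` of `χ`, a framed `θ : Γ_K →ₜ* GL₁(𝓞_{ℚ₂(S)})` with `θ² = 1` and `θ σ = 1 ↔ θ̂ σ = 1`, a Hecke
character `θK` with `KellerYin2024.IsHeckeCharOf ι θ θK`, exact ramification `θK ↔ θ` and
**`θK * θK = 1`**, and, with **`ρ := θK * λ`** (so `θK⁻¹ * ρ = λ`), the framed
`r := r₀ ⊗ det(r_θ)` with entries `χ(σ)·θ̂(σ)` such that **`IsPAdicAvatarOf ι ρ r`** and
**`FactorsThroughPair κ₁ κ₂ r` for EVERY generator pair** of the `ℤ₂²`-tower.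
[cite: deShalit1987, II.4.17 (54)] [cite: SerreAbelianLadic1968, Ch. II §2.7] -/
theorem exists_v10_triple (hK : IsImaginaryQuadratic K) {lam : HeckeCharacter K} (hlam : lam.IsAlgebraic)
    (χ : absoluteGaloisGroup K →ₜ* ℤ_[2]ˣ) {r₀ : FramedGaloisRep K (PadicAlgCl 2) 1}
    (hr₀χ : ∀ σ, (((r₀ σ : GL (Fin 1) (PadicAlgCl 2)) : Matrix (Fin 1) (Fin 1) (PadicAlgCl 2)) 0 0) =
      ((algebraMap ℚ_[2] (PadicAlgCl 2)).comp PadicInt.Coe.ringHom) ((χ σ : ℤ_[2]ˣ) : ℤ_[2]))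
    (hr₀ : IsPAdicAvatarOf ι lam r₀) :
    ∃ (θs : absoluteGaloisGroup K →ₜ* ℤ_[2]ˣ) (θ : FramedGaloisRep K (padicCoeffIntegers S) 1)
      (θK ρ : HeckeCharacter K) (r : FramedGaloisRep K (PadicAlgCl 2) 1),
      (∀ σ, θs σ = 1 ∨ θs σ = -1) ∧ (∀ σ, (4 : ℤ_[2]) ∣ (χ σ : ℤ_[2]) * (θs σ : ℤ_[2]) - 1) ∧
      (∀ σ, θ σ ^ 2 = 1) ∧ (∀ σ, θ σ = 1 ↔ θs σ = 1) ∧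
      θK.IsFiniteOrder ∧ IsHeckeCharOf ι θ θK ∧
      (∀ w : HeightOneSpectrum (𝓞 K), θK.IsUnramifiedAt w ↔ θ.IsUnramifiedAt w) ∧
      θK * θK = 1 ∧ ρ = θK * lam ∧ θK⁻¹ * ρ = lam ∧ IsPAdicAvatarOf ι ρ r ∧
      (∀ σ, (((r σ : GL (Fin 1) (PadicAlgCl 2)) : Matrix (Fin 1) (Fin 1) (PadicAlgCl 2)) 0 0) =
        ((algebraMap ℚ_[2] (PadicAlgCl 2)).comp PadicInt.Coe.ringHom)
          ((χ σ : ℤ_[2]ˣ) * (θs σ : ℤ_[2]ˣ) : ℤ_[2]ˣ)) ∧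
      ∀ {κ₁ κ₂ : ZpExtension K 2} {γ₁ γ₂ : absoluteGaloisGroup K},
        ZpExtension.IsTopGeneratorPair κ₁ κ₂ γ₁ γ₂ → FactorsThroughPair κ₁ κ₂ r := by
  obtain ⟨θs, θ, θK, rθ, hθs, hθsχ, hθ2, hθ1, hfin, hH, hram, hsq, hrθ, hrθ1, hav, hker⟩ :=
    exists_sign_heckeChar_avatar S ι hK χ
  set jr : ℤ_[2] →+* PadicAlgCl 2 := (algebraMap ℚ_[2] (PadicAlgCl 2)).comp PadicInt.Coe.ringHom
    with hjr
  -- the twisted avatar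
  set r : FramedGaloisRep K (PadicAlgCl 2) 1 := FramedRep.twist r₀ (detChar rθ) with hr
  have halg : (θK * lam).IsAlgebraic := (HeckeCharacter.IsFiniteOrder.isAlgebraic hfin).mul hlam
  have havatar : IsPAdicAvatarOf ι (θK * lam) r :=
    AvatarRigidity.isPAdicAvatarOf_mul_twist ι hr₀ hav halg
  have hentry : ∀ σ, (((r σ : GL (Fin 1) (PadicAlgCl 2)) : Matrix (Fin 1) (Fin 1) (PadicAlgCl 2)) 0 0) =
      jr ((χ σ : ℤ_[2]ˣ) * (θs σ : ℤ_[2]ˣ) : ℤ_[2]ˣ) := fun σ ↦ by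
    rw [hr, AvatarRigidity.entry_twist, AvatarRigidity.coe_detChar_eq_entry, hrθ σ 0 0, hr₀χ σ,
      Units.val_mul, map_mul, mul_comm]
  have hone : ∀ σ : absoluteGaloisGroup K, χ σ * θs σ = 1 → r σ = 1 := fun σ hσ ↦ by
    refine Matrix.GeneralLinearGroup.ext fun i j ↦ ?_
    rw [Subsingleton.elim i 0, Subsingleton.elim j 0, hentry σ, hσ, Units.val_one, map_one,
      Units.val_one, Matrix.one_apply_eq]
  refine ⟨θs, θ, θK, θK * lam, r, hθs, hθsχ, hθ2, hθ1, hfin, hH, hram, hsq, rfl,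
    inv_mul_cancel_left θK lam, havatar, hentry, fun hpair ↦ ?_⟩
  exact factorsThroughPair_of_sign_twist_of_isImaginaryQuadratic hK hθsχ hpair hone

end Summit.BirchSwinnertonDyer.BirchSwinnertonDyer.Theorems.PrintCf2.QuadraticPart

end
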